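import Literature.NumberTheory.Sieve.LinearEquationsInPrimesProofs
import Literature.NumberTheory.Sieve.LinearEquationsInPrimesSingularSeries
import Literature.NumberTheory.LFunctions.MertensElementary
import HarnessLib

/-!
# Route `LeeYangFibres`, item `AbsoluteUpgrade` (stmt-Parity-14116):
# `∏_p β_p ≪_{t,L} (log log N)^{t-1}` for non-degenerate `d = 1` systems

For `Ψ = (ψ_i(n) = a_i n + b_i)_{i < t}` non-degenerate with `‖Ψ‖_N ≤ L`: `|a_i| ≤ L`,
`|b_i| ≤ L N`, every `a_i ≠ 0` and every minor `D_{ik} = a_i b_k - a_k b_i ≠ 0` (`i ≠ k`).  At a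
prime `p > L` each `ψ_i` kills exactly the residue `-b_i/a_i`, so `β_p ≤ (p/(p-1))^{t-1}`, and if
`p ∤ D := N ∏_{i ≠ k} |D_{ik}|` the killed residues are distinct and `β_p ≤ 1` (Bernoulli); the
primes `p ≤ L` give at most `(2^t)^{L+1}`.  Hence every partial product is at most
`(2^t)^{L+1} ∏_{p ∣ D} (p/(p-1))^{t-1}`, and `∏_{p ∣ D} p/(p-1) = D/φ(D) ≤ 2e⁵ log log D`
(Landau, `MertensBound.totient_div_self_ge`) with `D ≤ N^{2t²+1}` for `N ≥ 2L² + 1`; the limit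
is Green–Tao's Lemma 1.3 (`tendsto_singularProductPartial_holds`).
-/

noncomputable section

namespace Summit.Parity.GeneralizedHardyLittlewood.Theorems.AbsoluteUpgrade

open Finset Filter Literature.NumberTheory.Sieve Literature.NumberTheory.LFunctions
open scoped Topology

variable {t : ℕ}

/-! ### Dimension one: `ψ_i(n) = a_i n + b_i` -/

/-- In dimension one, `ψ_p(v) = a v₀ + b` in `ℤ/p`. -/
private theorem modEval_dimOne (ψ : AffLinForm 1) (p : ℕ) (v : Fin 1 → ZMod p) :
    ψ.modEval p v = (ψ.coeff 0 : ZMod p) * v 0 + (ψ.const : ZMod p) := by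
  rw [AffLinForm.modEval, Fin.sum_univ_one]

/-- Non-degeneracy in dimension one: every leading coefficient `a_i` is non-zero. -/
private theorem coeff_ne_zero_dimOne {Ψ : Fin t → AffLinForm 1} (hΨ : IsNondegenerateSystem Ψ)
    (i : Fin t) : (Ψ i).coeff 0 ≠ 0 := by
  intro h
  apply hΨ.1 i
  funext j
  rw [Subsingleton.elim j 0, Pi.zero_apply]
  exact h

/-- Non-degeneracy in dimension one: the minors `a_i b_k - a_k b_i`, `i ≠ k`, are non-zero
(otherwise `a_k ψ_i = a_i ψ_k` pointwise, forcing `a_i = 0`). -/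
private theorem minor_ne_zero {Ψ : Fin t → AffLinForm 1} (hΨ : IsNondegenerateSystem Ψ)
    {i k : Fin t} (hik : i ≠ k) :
    (Ψ i).coeff 0 * (Ψ k).const - (Ψ k).coeff 0 * (Ψ i).const ≠ 0 := by
  intro hD
  have hpt : ∀ n, (Ψ k).coeff 0 * (Ψ i).eval n = (Ψ i).coeff 0 * (Ψ k).eval n := fun n => by
    simp only [AffLinForm.eval, Fin.sum_univ_one]
    linear_combination -hD
  exact coeff_ne_zero_dimOne hΨ i (hΨ.2 i k hik _ _ hpt).2

/-- `‖Ψ‖_N ≤ L` bounds the constants: `|b_i| ≤ L N` (`N ≥ 1`). -/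
private theorem natAbs_const_le {Ψ : Fin t → AffLinForm 1} {N L : ℕ} (hN : 1 ≤ N)
    (h : affLinSize Ψ N ≤ L) (i : Fin t) : ((Ψ i).const).natAbs ≤ L * N := by
  have hN0 : (0 : ℝ) < N := by exact_mod_cast hN
  have h1 : |((Ψ i).const : ℝ) / N| ≤ ∑ i', |((Ψ i').const : ℝ) / N| :=
    Finset.single_le_sum (f := fun i' => |((Ψ i').const : ℝ) / N|) (fun _ _ => abs_nonneg _)
      (Finset.mem_univ i)
  have h2 : ∑ i', |((Ψ i').const : ℝ) / N| ≤ affLinSize Ψ N :=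
    le_add_of_nonneg_left
      (Finset.sum_nonneg fun _ _ => Finset.sum_nonneg fun _ _ => abs_nonneg _)
  have h3 : |((Ψ i).const : ℝ)| ≤ L * N := by
    have := h1.trans (h2.trans h)
    rwa [abs_div, abs_of_pos hN0, div_le_iff₀ hN0] at this
  have h4 : (((Ψ i).const.natAbs : ℕ) : ℝ) ≤ ((L * N : ℕ) : ℝ) := by
    rw [Nat.cast_natAbs, Int.cast_abs]
    push_cast
    exact h3
  exact_mod_cast h4

/-- The minors are bounded: `|a_i b_k - a_k b_i| ≤ 2 L² N ≤ N²` once `N ≥ 2L² + 1`. -/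
private theorem natAbs_minor_le {Ψ : Fin t → AffLinForm 1} {N L : ℕ} (hLN : 2 * L ^ 2 + 1 ≤ N)
    (h : affLinSize Ψ N ≤ L) (i k : Fin t) :
    ((Ψ i).coeff 0 * (Ψ k).const - (Ψ k).coeff 0 * (Ψ i).const).natAbs ≤ N * N := by
  have ha := fun i => natAbs_coeff_le_of_affLinSize_le h i 0
  have hb := fun i => natAbs_const_le (le_trans (Nat.le_add_left 1 _) hLN) h i
  calc ((Ψ i).coeff 0 * (Ψ k).const - (Ψ k).coeff 0 * (Ψ i).const).natAbs
      ≤ ((Ψ i).coeff 0 * (Ψ k).const).natAbs + ((Ψ k).coeff 0 * (Ψ i).const).natAbs :=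
        Int.natAbs_sub_le _ _
    _ = ((Ψ i).coeff 0).natAbs * ((Ψ k).const).natAbs +
          ((Ψ k).coeff 0).natAbs * ((Ψ i).const).natAbs := by
        rw [Int.natAbs_mul, Int.natAbs_mul]
    _ ≤ L * (L * N) + L * (L * N) :=
        add_le_add (Nat.mul_le_mul (ha i) (hb k)) (Nat.mul_le_mul (ha k) (hb i))
    _ = (2 * L ^ 2) * N := by ring
    _ ≤ N * N := Nat.mul_le_mul_right N (Nat.le_of_succ_le hLN)

/-! ### Local factors at the primes `p > L` -/

/-- At a prime `p` where every `a_i` is a unit, `ψ_i` kills the residue `-b_i/a_i`: the good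
residues avoid the roots, so `goodCount Ψ p + #{-b_i/a_i : i} ≤ p`. -/
private theorem goodCount_add_card_roots_le {Ψ : Fin t → AffLinForm 1} {p : ℕ} [Fact p.Prime]
    (ha : ∀ i, ((Ψ i).coeff 0 : ZMod p) ≠ 0) :
    goodCount Ψ p + #(univ.image fun (i : Fin t) (_ : Fin 1) =>
      -((Ψ i).const : ZMod p) / ((Ψ i).coeff 0 : ZMod p)) ≤ p := by
  unfold goodCount
  rw [← Finset.card_union_of_disjoint]
  · calc _ ≤ Fintype.card (Fin 1 → ZMod p) := Finset.card_le_univ _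
      _ = p := by rw [card_zmod_pow, pow_one]
  · rw [Finset.disjoint_left]
    intro v hv hv'
    obtain ⟨i, -, rfl⟩ := Finset.mem_image.mp hv'
    refine (Finset.mem_filter.mp hv).2 i ?_
    rw [modEval_dimOne, ← eq_neg_iff_add_eq_zero, mul_div_assoc', mul_div_cancel_left₀ _ (ha i)]

/-- Bernoulli: for `p ≥ 2` and `G + t ≤ p`, `p⁻¹ (p/(p-1))^t G ≤ 1` (`1 - t/p ≤ (1 - 1/p)^t`). -/
private theorem inv_mul_pow_mul_le_one {p t : ℕ} (hp : 2 ≤ p) {G : ℝ} (hG : G + t ≤ p) :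
    ((p : ℝ) ^ 1)⁻¹ * (((p : ℝ) / (p - 1)) ^ t * G) ≤ 1 := by
  have hp2 : (2 : ℝ) ≤ p := by exact_mod_cast hp
  have hp0 : (0 : ℝ) < p := by linarith
  have hp1 : (0 : ℝ) < (p : ℝ) - 1 := by linarith
  have hp0' : (p : ℝ) ≠ 0 := hp0.ne'
  have hp1' : (p : ℝ) - 1 ≠ 0 := hp1.ne'
  have hX0 : (0 : ℝ) ≤ ((p : ℝ) / (p - 1)) ^ t := pow_nonneg (div_nonneg hp0.le hp1.le) t
  have hB : (p : ℝ) - t ≤ p * (1 - 1 / (p : ℝ)) ^ t := by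
    have ha : (-2 : ℝ) ≤ -(1 / (p : ℝ)) := by
      linarith [one_div_le_one_div_of_le two_pos hp2]
    calc (p : ℝ) - t = p * (1 + t * -(1 / (p : ℝ))) := by field_simp; ring
      _ ≤ p * (1 + -(1 / (p : ℝ))) ^ t := mul_le_mul_of_nonneg_left (one_add_mul_le_pow ha t) hp0.le
      _ = p * (1 - 1 / (p : ℝ)) ^ t := by ring
  have hXY : ((p : ℝ) / (p - 1)) ^ t * (1 - 1 / (p : ℝ)) ^ t = 1 := by
    rw [← mul_pow, show (p : ℝ) / (p - 1) * (1 - 1 / (p : ℝ)) = 1 by field_simp, one_pow]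
  rw [pow_one]
  calc (p : ℝ)⁻¹ * (((p : ℝ) / (p - 1)) ^ t * G)
      ≤ (p : ℝ)⁻¹ * (((p : ℝ) / (p - 1)) ^ t * (p * (1 - 1 / (p : ℝ)) ^ t)) :=
        mul_le_mul_of_nonneg_left (mul_le_mul_of_nonneg_left (by linarith) hX0)
          (inv_nonneg.mpr hp0.le)
    _ = (p : ℝ)⁻¹ * p * (((p : ℝ) / (p - 1)) ^ t * (1 - 1 / (p : ℝ)) ^ t) := by ring
    _ = 1 := by rw [hXY, inv_mul_cancel₀ hp0', one_mul]

/-- For `p ≥ 2`, `t ≥ 1` and `G + 1 ≤ p`: `p⁻¹ (p/(p-1))^t G ≤ (p/(p-1))^{t-1}`. -/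
private theorem inv_mul_pow_mul_le_pow {p t : ℕ} (hp : 2 ≤ p) (ht : 1 ≤ t) {G : ℝ}
    (hG : G + 1 ≤ p) :
    ((p : ℝ) ^ 1)⁻¹ * (((p : ℝ) / (p - 1)) ^ t * G) ≤ ((p : ℝ) / (p - 1)) ^ (t - 1) := by
  have hp2 : (2 : ℝ) ≤ p := by exact_mod_cast hp
  have hp0 : (0 : ℝ) < p := by linarith
  have hp1 : (0 : ℝ) < (p : ℝ) - 1 := by linarith
  have hp0' : (p : ℝ) ≠ 0 := hp0.ne'
  have hp1' : (p : ℝ) - 1 ≠ 0 := hp1.ne'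
  obtain ⟨s, rfl⟩ : ∃ s, t = s + 1 := ⟨t - 1, by omega⟩
  have hX0 : (0 : ℝ) ≤ ((p : ℝ) / (p - 1)) ^ (s + 1) := pow_nonneg (div_nonneg hp0.le hp1.le) _
  rw [pow_one, Nat.add_sub_cancel]
  calc (p : ℝ)⁻¹ * (((p : ℝ) / (p - 1)) ^ (s + 1) * G)
      ≤ (p : ℝ)⁻¹ * (((p : ℝ) / (p - 1)) ^ (s + 1) * ((p : ℝ) - 1)) :=
        mul_le_mul_of_nonneg_left (mul_le_mul_of_nonneg_left (by linarith) hX0)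
          (inv_nonneg.mpr hp0.le)
    _ = ((p : ℝ) / (p - 1)) ^ s * ((p : ℝ)⁻¹ * ((p : ℝ) / (p - 1)) * ((p : ℝ) - 1)) := by ring
    _ = ((p : ℝ) / (p - 1)) ^ s := by
        rw [show (p : ℝ)⁻¹ * ((p : ℝ) / (p - 1)) * ((p : ℝ) - 1) = 1 by field_simp, mul_one]

/-- At a prime `p` where all `a_i` are units (`t ≥ 1`): `β_p ≤ (p/(p-1))^{t-1}` (form `0` kills
a residue, so `goodCount Ψ p ≤ p - 1`). -/
private theorem localFactor_le_pow_pred {Ψ : Fin t → AffLinForm 1} {p : ℕ} (hp : p.Prime)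
    (ht : 1 ≤ t) (ha : ∀ i, ((Ψ i).coeff 0 : ZMod p) ≠ 0) :
    localFactor Ψ p ≤ ((p : ℝ) / (p - 1)) ^ (t - 1) := by
  haveI := Fact.mk hp
  haveI : Nonempty (Fin t) := ⟨⟨0, ht⟩⟩
  have h1 := Finset.card_pos.mpr (Finset.univ_nonempty.image fun (i : Fin t) (_ : Fin 1) =>
    -((Ψ i).const : ZMod p) / ((Ψ i).coeff 0 : ZMod p))
  have h2 := goodCount_add_card_roots_le ha
  have hG : (goodCount Ψ p : ℝ) + 1 ≤ p := by
    exact_mod_cast (by omega : goodCount Ψ p + 1 ≤ p)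
  rw [localFactor_prime]
  exact inv_mul_pow_mul_le_pow hp.two_le ht hG

/-- At a prime `p` where all `a_i` are units and all minors are non-zero: `β_p ≤ 1` (the `t`
killed residues `-b_i/a_i` are distinct, so `goodCount Ψ p ≤ p - t`, and Bernoulli). -/
private theorem localFactor_le_one_of_minors {Ψ : Fin t → AffLinForm 1} {p : ℕ} (hp : p.Prime)
    (ha : ∀ i, ((Ψ i).coeff 0 : ZMod p) ≠ 0)
    (hmin : ∀ i k, i ≠ k →
      (((Ψ i).coeff 0 * (Ψ k).const - (Ψ k).coeff 0 * (Ψ i).const : ℤ) : ZMod p) ≠ 0) :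
    localFactor Ψ p ≤ 1 := by
  haveI := Fact.mk hp
  have hinj : Function.Injective fun (i : Fin t) (_ : Fin 1) =>
      -((Ψ i).const : ZMod p) / ((Ψ i).coeff 0 : ZMod p) := by
    intro i k hik
    by_contra hne
    have h : -((Ψ i).const : ZMod p) / ((Ψ i).coeff 0 : ZMod p) =
        -((Ψ k).const : ZMod p) / ((Ψ k).coeff 0 : ZMod p) := congr_fun hik 0
    rw [div_eq_div_iff (ha i) (ha k)] at h
    refine hmin i k hne ?_
    push_cast
    linear_combination h
  have h2 := goodCount_add_card_roots_le ha
  rw [Finset.card_image_of_injective _ hinj, Finset.card_univ, Fintype.card_fin] at h2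
  have hG : (goodCount Ψ p : ℝ) + t ≤ p := by exact_mod_cast h2
  rw [localFactor_prime]
  exact inv_mul_pow_mul_le_one hp.two_le hG

/-! ### The partial products -/

/-- `0 ≤ p/(p-1)` and `1 ≤ p/(p-1)` for `p ≥ 2`. -/
private theorem div_pred_nonneg_one_le {p : ℕ} (hp : 2 ≤ p) :
    (0 : ℝ) ≤ (p : ℝ) / (p - 1) ∧ (1 : ℝ) ≤ (p : ℝ) / (p - 1) := by
  have hp2 : (2 : ℝ) ≤ p := by exact_mod_cast hp
  have hp1 : (0 : ℝ) < (p : ℝ) - 1 := by linarith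
  exact ⟨div_nonneg (by linarith) hp1.le, by rw [le_div_iff₀ hp1]; linarith⟩

/-- The small primes: `∏_{p ≤ x, p ≤ L} β_p ≤ (2^t)^{L+1}`. -/
private theorem prod_small_le (Ψ : Fin t → AffLinForm 1) (L x : ℕ) :
    ∏ p ∈ (Nat.primesLE x).filter (· ≤ L), localFactor Ψ p ≤ ((2 : ℝ) ^ t) ^ (L + 1) := by
  -- adapted from `Literature.NumberTheory.Sieve.singularProductPartial_le_uniform`
  calc ∏ p ∈ (Nat.primesLE x).filter (· ≤ L), localFactor Ψ p
      ≤ ∏ p ∈ (Nat.primesLE x).filter (· ≤ L), (2 : ℝ) ^ t := by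
        refine Finset.prod_le_prod (fun p _ => localFactor_nonneg Ψ p) fun p hp => ?_
        have hpp : p.Prime := (Nat.mem_primesLE.mp (Finset.mem_filter.mp hp).1).2
        exact (localFactor_prime_le Ψ hpp).trans (div_pred_pow_le_two_pow hpp.two_le t)
    _ = ((2 : ℝ) ^ t) ^ #((Nat.primesLE x).filter (· ≤ L)) := Finset.prod_const _
    _ ≤ ((2 : ℝ) ^ t) ^ (L + 1) := by
        refine pow_le_pow_right₀ (one_le_pow₀ (by norm_num)) ?_
        calc #((Nat.primesLE x).filter (· ≤ L)) ≤ #(Finset.range (L + 1)) :=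
              Finset.card_le_card fun p hp =>
                Finset.mem_range.mpr (Nat.lt_succ_of_le (Finset.mem_filter.mp hp).2)
          _ = L + 1 := Finset.card_range _

/-- The large primes: `∏_{p ≤ x, p > L} β_p ≤ ∏_{p ∣ D} (p/(p-1))^{t-1}` for any non-zero common
multiple `D` of the minors. -/
private theorem prod_large_le {Ψ : Fin t → AffLinForm 1} (hΨ : IsNondegenerateSystem Ψ)
    (ht : 1 ≤ t) {N L : ℕ} (h : affLinSize Ψ N ≤ L) (x : ℕ) {D : ℕ} (hD : D ≠ 0)
    (hdvd : ∀ i k, i ≠ k →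
      ((Ψ i).coeff 0 * (Ψ k).const - (Ψ k).coeff 0 * (Ψ i).const).natAbs ∣ D) :
    ∏ p ∈ (Nat.primesLE x).filter (fun p => ¬ p ≤ L), localFactor Ψ p ≤
      ∏ p ∈ D.primeFactors, ((p : ℝ) / (p - 1)) ^ (t - 1) := by
  have hmem : ∀ p ∈ (Nat.primesLE x).filter (fun p => ¬ p ≤ L), p.Prime ∧ L < p := fun p hp => by
    obtain ⟨hp1, hp2⟩ := Finset.mem_filter.mp hp
    exact ⟨(Nat.mem_primesLE.mp hp1).2, lt_of_not_ge hp2⟩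
  calc ∏ p ∈ (Nat.primesLE x).filter (fun p => ¬ p ≤ L), localFactor Ψ p
      ≤ ∏ p ∈ (Nat.primesLE x).filter (fun p => ¬ p ≤ L),
          (if p ∣ D then ((p : ℝ) / (p - 1)) ^ (t - 1) else 1) := by
        refine Finset.prod_le_prod (fun p _ => localFactor_nonneg Ψ p) fun p hp => ?_
        obtain ⟨hpp, hpL⟩ := hmem p hp
        have ha : ∀ i, ((Ψ i).coeff 0 : ZMod p) ≠ 0 := fun i =>
          intCast_zmod_ne_zero_of_natAbs_lt (coeff_ne_zero_dimOne hΨ i)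
            ((natAbs_coeff_le_of_affLinSize_le h i 0).trans_lt hpL)
        split_ifs with hpD
        · exact localFactor_le_pow_pred hpp ht ha
        · refine localFactor_le_one_of_minors hpp ha fun i k hik hz => hpD ?_
          rw [ZMod.intCast_zmod_eq_zero_iff_dvd, Int.natCast_dvd] at hz
          exact hz.trans (hdvd i k hik)
    _ = ∏ p ∈ ((Nat.primesLE x).filter (fun p => ¬ p ≤ L)).filter (· ∣ D),
          ((p : ℝ) / (p - 1)) ^ (t - 1) :=
        (Finset.prod_filter _ _).symm
    _ ≤ ∏ p ∈ D.primeFactors, ((p : ℝ) / (p - 1)) ^ (t - 1) := by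
        refine Finset.prod_le_prod_of_subset_of_one_le (fun p hp => ?_) (fun p hp => ?_)
          (fun p hp _ => ?_)
        · obtain ⟨hp1, hp2⟩ := Finset.mem_filter.mp hp
          exact Nat.mem_primeFactors.mpr ⟨(hmem p hp1).1, hp2, hD⟩
        · exact pow_nonneg
            (div_pred_nonneg_one_le (hmem p (Finset.mem_filter.mp hp).1).1.two_le).1 _
        · exact one_le_pow₀ (div_pred_nonneg_one_le (Nat.prime_of_mem_primeFactors hp).two_le).2

/-- `9 ≤ log N` and `2 ≤ log log N` for `N ≥ 3^9` (`log 3 > 1`). -/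
private theorem nine_le_log {N : ℕ} (hN : 3 ^ 9 ≤ N) :
    9 ≤ Real.log N ∧ 2 ≤ Real.log (Real.log N) := by
  -- adapted from `Literature.NumberTheory.LFunctions.MertensBound.totient_div_self_ge`
  have h3 := MertensBound.one_lt_log_three
  have hy9 : 9 ≤ Real.log N := by
    have h1 : Real.log ((3 : ℕ) ^ 9 : ℕ) ≤ Real.log N :=
      Real.log_le_log (by positivity) (by exact_mod_cast hN)
    rw [Nat.cast_pow, Real.log_pow] at h1
    push_cast at h1
    linarith
  have h1 : Real.log 9 ≤ Real.log (Real.log N) := Real.log_le_log (by norm_num) hy9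
  rw [show (9 : ℝ) = 3 ^ 2 by norm_num, Real.log_pow] at h1
  exact ⟨hy9, by push_cast at h1; linarith⟩

/-- Landau: `∏_{p ∣ m} p/(p-1) = m/φ(m) ≤ 2 e⁵ log log m` for `m ≥ 3^9`
(`MertensBound.totient_div_self_ge` and Euler's product
`MertensBound.totient_eq_mul_prod_one_sub_inv`). -/
private theorem prod_primeFactors_le_loglog {m : ℕ} (hm : 3 ^ 9 ≤ m) :
    ∏ p ∈ m.primeFactors, ((p : ℝ) / (p - 1)) ≤ 2 * Real.exp 5 * Real.log (Real.log m) := by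
  have hm0 : (0 : ℝ) < m := by exact_mod_cast lt_of_lt_of_le (by norm_num) hm
  have hll : 0 < Real.log (Real.log m) := by linarith [(nine_le_log hm).2]
  have h := MertensBound.totient_div_self_ge m hm
  rw [MertensBound.totient_eq_mul_prod_one_sub_inv, mul_div_cancel_left₀ _ hm0.ne'] at h
  have hPQ : (∏ p ∈ m.primeFactors, ((p : ℝ) / (p - 1))) *
      ∏ p ∈ m.primeFactors, (1 - 1 / (p : ℝ)) = 1 := by
    rw [← Finset.prod_mul_distrib]
    refine Finset.prod_eq_one fun p hp => ?_
    have hp2 : (2 : ℝ) ≤ p := by exact_mod_cast (Nat.prime_of_mem_primeFactors hp).two_le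
    have hp0 : (p : ℝ) ≠ 0 := by positivity
    have hp1 : (p : ℝ) - 1 ≠ 0 := by linarith
    field_simp
  have hP0 : 0 ≤ ∏ p ∈ m.primeFactors, ((p : ℝ) / (p - 1)) := Finset.prod_nonneg fun p hp =>
    (div_pred_nonneg_one_le (Nat.prime_of_mem_primeFactors hp).two_le).1
  have h1 : (∏ p ∈ m.primeFactors, ((p : ℝ) / (p - 1))) * (Real.exp (-5) /
      (2 * Real.log (Real.log m))) ≤ 1 :=
    (mul_le_mul_of_nonneg_left h hP0).trans_eq hPQ
  rw [mul_div_assoc', div_le_one (by positivity)] at h1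
  calc ∏ p ∈ m.primeFactors, ((p : ℝ) / (p - 1))
      = (∏ p ∈ m.primeFactors, ((p : ℝ) / (p - 1))) * Real.exp (-5) * Real.exp 5 := by
        rw [mul_assoc, ← Real.exp_add]; norm_num
    _ ≤ 2 * Real.log (Real.log m) * Real.exp 5 := mul_le_mul_of_nonneg_right h1 (Real.exp_pos _).le
    _ = 2 * Real.exp 5 * Real.log (Real.log m) := by ring

/-- **Uniform bound for the partial products**: for `N ≥ 3^9 (2L² + 1)`, every `x`, and every
non-degenerate `d = 1` system with `‖Ψ‖_N ≤ L`,
`∏_{p ≤ x} β_p ≤ (2^t)^{L+1} (2e⁵(2t² + 1))^{t-1} (log log N)^{t-1}`. -/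
theorem singularProductPartial_le_loglog_pow {t L N : ℕ} (ht : 1 ≤ t)
    (hN : 3 ^ 9 * (2 * L ^ 2 + 1) ≤ N) {Ψ : Fin t → AffLinForm 1} (hΨ : IsNondegenerateSystem Ψ)
    (h : affLinSize Ψ N ≤ L) (x : ℕ) :
    singularProductPartial Ψ x ≤
      ((2 : ℝ) ^ t) ^ (L + 1) * (2 * Real.exp 5 * (2 * t ^ 2 + 1)) ^ (t - 1) *
        Real.log (Real.log N) ^ (t - 1) := by
  have hN9 : 3 ^ 9 ≤ N := le_trans (Nat.le_mul_of_pos_right _ (Nat.succ_pos _)) hN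
  have hLN : 2 * L ^ 2 + 1 ≤ N := le_trans (Nat.le_mul_of_pos_left _ (by positivity)) hN
  have hN1 : 1 ≤ N := le_trans (Nat.le_add_left 1 _) hLN
  have hN0 : (0 : ℝ) < N := by exact_mod_cast hN1
  obtain ⟨hlogN, hllN⟩ := nine_le_log hN9
  -- the common multiple `D = N ∏_{i ≠ k} |D_{ik}|` of the minors
  set D : ℕ := N * ∏ ik ∈ (univ : Finset (Fin t)).offDiag,
    ((Ψ ik.1).coeff 0 * (Ψ ik.2).const - (Ψ ik.2).coeff 0 * (Ψ ik.1).const).natAbs with hDdef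
  have hP0 : ∏ ik ∈ (univ : Finset (Fin t)).offDiag,
      ((Ψ ik.1).coeff 0 * (Ψ ik.2).const - (Ψ ik.2).coeff 0 * (Ψ ik.1).const).natAbs ≠ 0 :=
    Finset.prod_ne_zero_iff.mpr fun ik hik =>
      Int.natAbs_ne_zero.mpr (minor_ne_zero hΨ (Finset.mem_offDiag.mp hik).2.2)
  have hD0 : D ≠ 0 := Nat.mul_ne_zero (by omega) hP0
  have hD9 : 3 ^ 9 ≤ D := le_trans hN9 (Nat.le_mul_of_pos_right N (Nat.pos_of_ne_zero hP0))
  have hdvd : ∀ i k, i ≠ k →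
      ((Ψ i).coeff 0 * (Ψ k).const - (Ψ k).coeff 0 * (Ψ i).const).natAbs ∣ D :=
    fun i k hik => Dvd.dvd.mul_left (Finset.dvd_prod_of_mem (fun ik : Fin t × Fin t =>
      ((Ψ ik.1).coeff 0 * (Ψ ik.2).const - (Ψ ik.2).coeff 0 * (Ψ ik.1).const).natAbs)
      (a := (i, k)) (Finset.mem_offDiag.mpr ⟨Finset.mem_univ i, Finset.mem_univ k, hik⟩)) N
  -- `D ≤ N^{2t² + 1}`, so `log log D ≤ (2t² + 1) log log N`
  have hDle : D ≤ N * (N * N) ^ (t * t) := by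
    refine Nat.mul_le_mul_left N ?_
    calc _ ≤ ∏ ik ∈ (univ : Finset (Fin t)).offDiag, (N * N) :=
          Finset.prod_le_prod (fun _ _ => Nat.zero_le _) fun ik _ => natAbs_minor_le hLN h ik.1 ik.2
      _ = (N * N) ^ #((univ : Finset (Fin t)).offDiag) := Finset.prod_const _
      _ ≤ (N * N) ^ (t * t) := by
          refine Nat.pow_le_pow_right (Nat.mul_pos hN1 hN1) ?_
          rw [Finset.offDiag_card, Finset.card_univ, Fintype.card_fin]
          exact Nat.sub_le _ _
  have hlogD : Real.log D ≤ (2 * t ^ 2 + 1) * Real.log N := by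
    have h1 : (D : ℝ) ≤ N * ((N : ℝ) * N) ^ (t * t) := by exact_mod_cast hDle
    have h2 := Real.log_le_log (by exact_mod_cast Nat.pos_of_ne_zero hD0) h1
    rw [Real.log_mul hN0.ne' (by positivity), Real.log_pow, Real.log_mul hN0.ne' hN0.ne'] at h2
    push_cast at h2
    linarith
  have hll : Real.log (Real.log D) ≤ (2 * t ^ 2 + 1) * Real.log (Real.log N) := by
    have hD1 : (1 : ℝ) < D := by exact_mod_cast lt_of_lt_of_le (by norm_num) hD9
    have ht0 : (0 : ℝ) < 2 * t ^ 2 + 1 := by positivity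
    calc Real.log (Real.log D) ≤ Real.log ((2 * t ^ 2 + 1) * Real.log N) :=
          Real.log_le_log (Real.log_pos hD1) hlogD
      _ = Real.log (2 * t ^ 2 + 1) + Real.log (Real.log N) := Real.log_mul ht0.ne' (by linarith)
      _ ≤ 2 * t ^ 2 + Real.log (Real.log N) := by linarith [Real.log_le_sub_one_of_pos ht0]
      _ ≤ (2 * t ^ 2 + 1) * Real.log (Real.log N) := by
          nlinarith [(by positivity : (0 : ℝ) ≤ 2 * t ^ 2)]
  -- `∏_{p ∣ D} (p/(p-1))^{t-1} = (D/φ(D))^{t-1} ≤ (2e⁵ (2t²+1) log log N)^{t-1}`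
  have hratio : ∏ p ∈ D.primeFactors, ((p : ℝ) / (p - 1)) ^ (t - 1) ≤
      (2 * Real.exp 5 * (2 * t ^ 2 + 1) * Real.log (Real.log N)) ^ (t - 1) := by
    rw [Finset.prod_pow]
    refine pow_le_pow_left₀ (Finset.prod_nonneg fun p hp =>
      (div_pred_nonneg_one_le (Nat.prime_of_mem_primeFactors hp).two_le).1) ?_ _
    calc ∏ p ∈ D.primeFactors, ((p : ℝ) / (p - 1)) ≤ 2 * Real.exp 5 * Real.log (Real.log D) :=
          prod_primeFactors_le_loglog hD9
      _ ≤ 2 * Real.exp 5 * ((2 * t ^ 2 + 1) * Real.log (Real.log N)) :=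
          mul_le_mul_of_nonneg_left hll (by positivity)
      _ = _ := by ring
  unfold singularProductPartial
  rw [← Finset.prod_filter_mul_prod_filter_not (Nat.primesLE x) (fun p => p ≤ L)]
  calc _ ≤ ((2 : ℝ) ^ t) ^ (L + 1) *
        (2 * Real.exp 5 * (2 * t ^ 2 + 1) * Real.log (Real.log N)) ^ (t - 1) :=
        mul_le_mul (prod_small_le Ψ L x) ((prod_large_le hΨ ht h x hD0 hdvd).trans hratio)
          (Finset.prod_nonneg fun p _ => localFactor_nonneg Ψ p) (by positivity)
    _ = _ := by rw [mul_pow]; ring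

/-- **S1.** `∏_p β_p ≤ C(t, L) (log log N)^{t-1}` uniformly over non-degenerate `d = 1` systems of
`t` forms with `‖Ψ‖_N ≤ L`, `N ≥ N₀ = 3^9 (2L² + 1)`: the uniform bound for the partial products
passes to the ordered limit `singularProduct Ψ` by Green–Tao's Lemma 1.3
(`tendsto_singularProductPartial_holds`). -/
theorem stub_singularProduct_le_loglog_pow (t L : ℕ) (ht : 1 ≤ t) :
    ∃ C : ℝ, 0 < C ∧ ∃ N₀ : ℕ, ∀ N : ℕ, N₀ ≤ N → ∀ Ψ : Fin t → AffLinForm 1,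
      IsNondegenerateSystem Ψ → affLinSize Ψ N ≤ L →
        singularProduct Ψ ≤ C * Real.log (Real.log N) ^ (t - 1) := by
  refine ⟨((2 : ℝ) ^ t) ^ (L + 1) * (2 * Real.exp 5 * (2 * t ^ 2 + 1)) ^ (t - 1), by positivity,
    3 ^ 9 * (2 * L ^ 2 + 1), fun N hN Ψ hΨ hL => ?_⟩
  exact le_of_tendsto' (tendsto_singularProductPartial_holds 1 t Ψ hΨ)
    fun x => singularProductPartial_le_loglog_pow ht hN hΨ hL x

end Summit.Parity.GeneralizedHardyLittlewood.Theorems.AbsoluteUpgrade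

end
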